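import Mathlib
import HarnessLib
import Literature.Analysis.Calculus.IteratedFDerivSymmetric
import Summits.NavierStokesRegularity.NavierStokesRegularity.Theorems.PoloidalWindowDoorLrcModEntireRidgeGlobalBranchODE

/-!
# Item `LrcModEntire` (stmt-NavierStokesRegularity-20428) — BRANCH-PARAM, part 2: horizontal frame algebra and the acceleration identity

LEAD of item 20428 ns-poloidal-K2-p3 g15 (`--supports stmt-NavierStokesRegularity-20428 --as helper`).  Elementary linear algebra in the thread plane
`P₀ = {y₂ = 0} ⊂ ℝ³` used by the hot-branch construction (`…RidgeGlobalBranchODE`, `…RidgeGlobalBranchLocal`, `…RidgeGlobalBranch`):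

* `rotJ` — the in-plane quarter turn `(x₀, x₁, x₂) ↦ (−x₁, x₀, 0)` (port-2's normal `ν = ![−γ′₁, γ′₀, 0]` is `rotJ γ′`); for a horizontal unit `u`, `(u, rotJ u)` is an
  orthonormal frame of the plane (`horiz_expand`);
* `frame_trace` — `B(u,u) + B(Ju,Ju) = B(e₀,e₀) + B(e₁,e₁)` for every bilinear `B`;
* `hessian_eq_of_kernel` — a symmetric `B` with `B(u,·) = 0` and trace `−κ` is `−κ · (Ju ⊗ Ju)` on horizontal vectors;
* `accel_eq_of_jets` — **the acceleration identity**: if moreover `q + B(u′,·) = 0` for a covector `q`, `u′` horizontal and `⟪u, u′⟫ = 0`, then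
  `u′ = −κ⁻²·P B[P q^♯]`, i.e. `u′` IS the second component of `branchField` once `q = D³f(y)[u,u,·]` and `B = D²f(y)`;
* currency bridges `fderiv_fderiv_eq_D2c`, `fderiv3_eq_iteratedFDeriv`, `D3n_eq_fderiv3` between nested `fderiv`s and the `iteratedFDeriv` scalars of the ODE file
  (third-slot symmetry from `Literature.Analysis.Calculus.iteratedFDeriv_apply_perm_of_le`).

Class-free.  WHAT THIS IS NOT: not a claim about Navier–Stokes regularity (bears_on LADDER-NS N0, item 20428 / crux 19708; 20428/19708/27893 OPEN).
-/

noncomputable section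

-- the summit and its single sub-problem share the name (CONVENTIONS §1), as in every Theorems file
set_option linter.dupNamespace false

namespace Summit.NavierStokesRegularity.NavierStokesRegularity.Theorems.PoloidalWindowDoorLrcModEntireRidgeGlobalBranchFrame

open Set Filter Topology Metric Function
open scoped NNReal InnerProductSpace RealInnerProductSpace ContDiff
open Summit.NavierStokesRegularity.NavierStokesRegularity.Theorems.PoloidalWindowDoorLrcModEntireRidgeGlobalBranchODE

/-! ### The in-plane quarter turn and the horizontal frame -/

/-- The in-plane quarter turn `(x₀,x₁,x₂) ↦ (−x₁, x₀, 0)`. -/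
def rotJ (x : EuclideanSpace ℝ (Fin 3)) : EuclideanSpace ℝ (Fin 3) := WithLp.toLp 2 ![-(x 1), x 0, 0]

/-- Coordinates of `rotJ x`. -/
@[simp] theorem rotJ_apply (x : EuclideanSpace ℝ (Fin 3)) : rotJ x 0 = -(x 1) ∧ rotJ x 1 = x 0 ∧ rotJ x 2 = 0 := by
  simp [rotJ]

/-- The inner product on `ℝ³` in coordinates. -/
theorem inner_eq_sum3 (x y : EuclideanSpace ℝ (Fin 3)) : ⟪x, y⟫ = x 0 * y 0 + x 1 * y 1 + x 2 * y 2 := by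
  simp [EuclideanSpace.inner_eq_star_dotProduct, dotProduct, Fin.sum_univ_three, mul_comm]

/-- The squared norm on `ℝ³` in coordinates. -/
theorem norm_sq_eq_sum3 (x : EuclideanSpace ℝ (Fin 3)) : ‖x‖ ^ 2 = x 0 ^ 2 + x 1 ^ 2 + x 2 ^ 2 := by
  rw [EuclideanSpace.norm_sq_eq, Fin.sum_univ_three]
  simp [sq_abs]

/-- A horizontal unit vector has `u₀² + u₁² = 1`. -/
theorem sq_add_sq_of_horizontal_unit {u : EuclideanSpace ℝ (Fin 3)} (hu2 : u 2 = 0) (hun : ‖u‖ = 1) : u 0 ^ 2 + u 1 ^ 2 = 1 := by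
  have h := norm_sq_eq_sum3 u
  rw [hun, hu2] at h
  nlinarith

/-- `rotJ u` is a horizontal unit vector orthogonal to the horizontal unit `u`. -/
theorem rotJ_facts {u : EuclideanSpace ℝ (Fin 3)} (hu2 : u 2 = 0) (hun : ‖u‖ = 1) :
    rotJ u 2 = 0 ∧ ‖rotJ u‖ = 1 ∧ ⟪u, rotJ u⟫ = 0 ∧ ⟪rotJ u, u⟫ = 0 := by
  have hab := sq_add_sq_of_horizontal_unit hu2 hun
  refine ⟨by simp, ?_, ?_, ?_⟩
  · have h := norm_sq_eq_sum3 (rotJ u)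
    simp only [rotJ_apply] at h
    have h1 : ‖rotJ u‖ ^ 2 = 1 := by rw [h]; nlinarith
    nlinarith [norm_nonneg (rotJ u)]
  · rw [inner_eq_sum3]; simp [hu2]; ring
  · rw [inner_eq_sum3]; simp [hu2]; ring

/-- A horizontal vector in the frame `(e₀, e₁)`. -/
theorem horiz_eq_e0_e1 {w : EuclideanSpace ℝ (Fin 3)} (hw2 : w 2 = 0) : w = w 0 • e0 + w 1 • e1 := by
  ext i; fin_cases i <;> simp [e0, e1, hw2]

/-- **Orthonormal expansion** of a horizontal vector in the frame `(u, rotJ u)`. -/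
theorem horiz_expand {w u : EuclideanSpace ℝ (Fin 3)} (hw2 : w 2 = 0) (hu2 : u 2 = 0) (hun : ‖u‖ = 1) :
    w = ⟪w, u⟫ • u + ⟪w, rotJ u⟫ • rotJ u := by
  have hab := sq_add_sq_of_horizontal_unit hu2 hun
  ext i
  fin_cases i
  · simp [inner_eq_sum3, hu2, hw2]
    linear_combination (-(w 0)) * hab
  · simp [inner_eq_sum3, hu2, hw2]
    linear_combination (-(w 1)) * hab
  · simp [hw2, hu2]

/-- Coordinates of an inner product with horizontal vectors. -/
theorem inner_horizontal {w u : EuclideanSpace ℝ (Fin 3)} (hu2 : u 2 = 0) :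
    ⟪w, u⟫ = w 0 * u 0 + w 1 * u 1 ∧ ⟪w, rotJ u⟫ = -(w 0 * u 1) + w 1 * u 0 := by
  constructor
  · rw [inner_eq_sum3, hu2]; ring
  · rw [inner_eq_sum3]; simp

/-! ### Bilinear forms in the horizontal frame -/

section bilinear

variable (B : EuclideanSpace ℝ (Fin 3) →L[ℝ] EuclideanSpace ℝ (Fin 3) →L[ℝ] ℝ)

/-- Expansion of `B` on horizontal vectors in the frame `(e₀, e₁)`. -/
theorem bilin_horizontal {X Y : EuclideanSpace ℝ (Fin 3)} (hX : X 2 = 0) (hY : Y 2 = 0) :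
    B X Y = X 0 * Y 0 * B e0 e0 + X 0 * Y 1 * B e0 e1 + X 1 * Y 0 * B e1 e0 + X 1 * Y 1 * B e1 e1 := by
  conv_lhs => rw [horiz_eq_e0_e1 hX, horiz_eq_e0_e1 hY]
  simp only [map_add, map_smul, add_apply, smul_apply, smul_eq_mul]
  ring

/-- **Frame invariance of the horizontal trace**: `B(u,u) + B(Ju,Ju) = B(e₀,e₀) + B(e₁,e₁)` for a horizontal unit `u`. -/
theorem frame_trace {u : EuclideanSpace ℝ (Fin 3)} (hu2 : u 2 = 0) (hun : ‖u‖ = 1) :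
    B u u + B (rotJ u) (rotJ u) = B e0 e0 + B e1 e1 := by
  have hab := sq_add_sq_of_horizontal_unit hu2 hun
  rw [bilin_horizontal B hu2 hu2, bilin_horizontal B (rotJ_facts hu2 hun).1 (rotJ_facts hu2 hun).1]
  simp only [rotJ_apply]
  linear_combination (B e0 e0 + B e1 e1) * hab

/-- **The Hessian block of a non-degenerate critical curve**: a symmetric `B` with kernel vector `u` (horizontal unit) and horizontal trace `−κ` has the
frame entries `B(e₀,e₀) = −κ u₁²`, `B(e₀,e₁) = B(e₁,e₀) = κ u₀u₁`, `B(e₁,e₁) = −κ u₀²` — i.e. `B = −κ · (Ju ⊗ Ju)` on the plane. -/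
theorem frame_entries_of_kernel {u : EuclideanSpace ℝ (Fin 3)} (hu2 : u 2 = 0) (hun : ‖u‖ = 1) {κ : ℝ}
    (hsym : B e0 e1 = B e1 e0) (hker : ∀ w, B u w = 0) (htr : B e0 e0 + B e1 e1 = -κ) :
    B e0 e0 = -κ * u 1 ^ 2 ∧ B e0 e1 = κ * (u 0 * u 1) ∧ B e1 e0 = κ * (u 0 * u 1) ∧ B e1 e1 = -κ * u 0 ^ 2 := by
  have hab := sq_add_sq_of_horizontal_unit hu2 hun
  have h0 := hker e0
  have h1 := hker e1
  rw [bilin_horizontal B hu2 (by simp : e0 2 = 0)] at h0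
  rw [bilin_horizontal B hu2 (by simp : e1 2 = 0)] at h1
  simp only [e0_apply, e1_apply, mul_one, mul_zero, zero_mul, add_zero, zero_add] at h0 h1
  -- `h0 : u₀ B₀₀ + u₁ B₁₀ = 0`, `h1 : u₀ B₀₁ + u₁ B₁₁ = 0`
  have hB00 : B e0 e0 = -κ * u 1 ^ 2 := by
    linear_combination (u 0) * h0 - (u 1) * h1 + (u 0 * u 1) * hsym + (u 1) ^ 2 * htr - (B e0 e0) * hab
  have hB11 : B e1 e1 = -κ * u 0 ^ 2 := by
    linear_combination htr - hB00 + κ * hab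
  have hB10 : B e1 e0 = κ * (u 0 * u 1) := by
    linear_combination (u 1) * h0 + (u 0) * h1 - (u 0) ^ 2 * hsym - (u 0 * u 1) * htr - (B e1 e0) * hab
  exact ⟨hB00, by linear_combination hsym + hB10, hB10, hB11⟩

/-- **THE ACCELERATION IDENTITY.**  Let `u` be a horizontal unit vector, `B` symmetric with `B(u,·) = 0` and horizontal trace `−κ ≠ 0`, `q` a covector with
`q + B(u′,·) = 0` for a horizontal `u′ ⊥ u`.  Then `u′ = −κ⁻² · ((q e₀·B₀₀ + q e₁·B₁₀) e₀ + (q e₀·B₀₁ + q e₁·B₁₁) e₁)` — the formula of `accel`. -/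
theorem accel_eq_of_jets {u u' : EuclideanSpace ℝ (Fin 3)} (hu2 : u 2 = 0) (hun : ‖u‖ = 1) (hu'2 : u' 2 = 0) (horth : ⟪u, u'⟫ = 0)
    {κ : ℝ} (hκ : κ ≠ 0) (hsym : B e0 e1 = B e1 e0) (hker : ∀ w, B u w = 0) (htr : B e0 e0 + B e1 e1 = -κ)
    (q : EuclideanSpace ℝ (Fin 3) →L[ℝ] ℝ) (hq : ∀ w, q w + B u' w = 0) :
    u' = -(κ⁻¹ ^ 2) • ((q e0 * B e0 e0 + q e1 * B e1 e0) • e0 + (q e0 * B e0 e1 + q e1 * B e1 e1) • e1) := by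
  obtain ⟨hB00, hB01, hB10, hB11⟩ := frame_entries_of_kernel B hu2 hun hsym hker htr
  have hab := sq_add_sq_of_horizontal_unit hu2 hun
  have horth' : u 0 * u' 0 + u 1 * u' 1 = 0 := by
    have h := (inner_horizontal (w := u) hu'2).1
    rw [real_inner_comm] at horth
    rw [← h]; simpa [real_inner_comm] using horth
  have hq0 : q e0 = -(u' 0 * B e0 e0 + u' 1 * B e1 e0) := by
    have h := hq e0
    rw [bilin_horizontal B hu'2 (by simp : e0 2 = 0)] at h
    simp only [e0_apply, mul_one, mul_zero, zero_mul, add_zero] at h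
    linarith
  have hq1 : q e1 = -(u' 0 * B e0 e1 + u' 1 * B e1 e1) := by
    have h := hq e1
    rw [bilin_horizontal B hu'2 (by simp : e1 2 = 0)] at h
    simp only [e1_apply, mul_one, mul_zero, zero_mul, add_zero, zero_add] at h
    linarith
  have hk : κ⁻¹ * κ = 1 := inv_mul_cancel₀ hκ
  ext i
  fin_cases i
  · simp only [Fin.zero_eta, Fin.isValue, PiLp.smul_apply, PiLp.add_apply, e0_apply, e1_apply, smul_eq_mul, mul_one,
      mul_zero, add_zero]
    rw [hq0, hq1, hB00, hB01, hB10, hB11]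
    linear_combination (u 0) * horth' - (u' 0) * hab - (u 1 * (u' 0 * u 1 - u' 1 * u 0)) * hab -
      ((u 0 ^ 2 + u 1 ^ 2) * (u 1 * (u' 0 * u 1 - u' 1 * u 0)) * (κ⁻¹ * κ + 1)) * hk
  · simp only [Fin.mk_one, Fin.isValue, PiLp.smul_apply, PiLp.add_apply, e0_apply, e1_apply, smul_eq_mul, mul_one,
      mul_zero, zero_add]
    rw [hq0, hq1, hB00, hB01, hB10, hB11]
    linear_combination (u 1) * horth' - (u' 1) * hab - (u 0 * (u' 1 * u 0 - u' 0 * u 1)) * hab -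
      ((u 0 ^ 2 + u 1 ^ 2) * (u 0 * (u' 1 * u 0 - u' 0 * u 1)) * (κ⁻¹ * κ + 1)) * hk
  · simp [hu'2]

end bilinear

/-! ### Currency bridges: nested `fderiv`s versus the `iteratedFDeriv` scalars of the ODE file -/

section bridges

variable {f : EuclideanSpace ℝ (Fin 3) → ℝ}

/-- `D²f(y)[a,b]` in the two currencies. -/
theorem fderiv_fderiv_eq_D2c (a b y : EuclideanSpace ℝ (Fin 3)) : fderiv ℝ (fderiv ℝ f) y a b = D2c f a b y := by
  rw [D2c, iteratedFDeriv_two_apply]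
  simp

/-- `D³f(y)[a,b,c]` as three nested Fréchet derivatives (outermost direction first). -/
theorem fderiv3_eq_iteratedFDeriv (hf : ContDiff ℝ 3 f) (y a b c : EuclideanSpace ℝ (Fin 3)) :
    fderiv ℝ (fderiv ℝ (fderiv ℝ f)) y a b c = iteratedFDeriv ℝ 3 f y ![a, b, c] := by
  have h2d : Differentiable ℝ (iteratedFDeriv ℝ 2 f) := hf.differentiable_iteratedFDeriv (by norm_cast)
  rw [iteratedFDeriv_succ_apply_left]
  have htail : Fin.tail ![a, b, c] = ![b, c] := by
    funext i; fin_cases i <;> rfl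
  simp only [Matrix.cons_val_zero, htail]
  rw [← fderiv_continuousMultilinear_apply_const_apply (h2d y) ![b, c] a]
  have hfun : (fun x => iteratedFDeriv ℝ 2 f x ![b, c]) = fun x => fderiv ℝ (fderiv ℝ f) x b c := by
    funext x; rw [iteratedFDeriv_two_apply]; simp
  rw [hfun]
  -- differentiate `x ↦ (D²f(x) b) c` : evaluation is linear
  have hd2 : ContDiff ℝ 1 (fderiv ℝ (fderiv ℝ f)) :=
    ((hf.fderiv_right (m := 2) (by norm_cast)).fderiv_right (m := 1) (by norm_cast))
  have hc₁ : DifferentiableAt ℝ (fderiv ℝ (fderiv ℝ f)) y := hd2.differentiable (by norm_num) y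
  have hc₂ : DifferentiableAt ℝ (fun x => fderiv ℝ (fderiv ℝ f) x b) y := hc₁.clm_apply (differentiableAt_const b)
  rw [fderiv_clm_apply hc₂ (differentiableAt_const c), fderiv_clm_apply hc₁ (differentiableAt_const b)]
  simp

/-- The ODE file's `D3n` at unit speed is the nested third derivative `D³f(y)[u,u,w]` (slot symmetry of `D³f`). -/
theorem D3n_eq_fderiv3 (hf : ContDiff ℝ 3 f) {u : EuclideanSpace ℝ (Fin 3)} (hu : ‖u‖ = 1) (w y : EuclideanSpace ℝ (Fin 3)) :
    D3n f w y u = fderiv ℝ (fderiv ℝ (fderiv ℝ f)) y u u w := by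
  rw [D3n, clip_of_norm_eq_one hu, fderiv3_eq_iteratedFDeriv hf]
  have h := Literature.Analysis.Calculus.iteratedFDeriv_apply_perm_of_le (hf.contDiffAt (x := y)) le_rfl ![u, u, w]
    (Equiv.swap 0 2)
  have hv : (fun i => (![u, u, w] : Fin 3 → EuclideanSpace ℝ (Fin 3)) ((Equiv.swap (0 : Fin 3) 2) i)) = ![w, u, u] := by
    funext i; fin_cases i <;> simp [Equiv.swap_apply_of_ne_of_ne]
  rw [hv] at h
  exact h

end bridges

end Summit.NavierStokesRegularity.NavierStokesRegularity.Theorems.PoloidalWindowDoorLrcModEntireRidgeGlobalBranchFrame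

end
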